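import Summits.BirchSwinnertonDyer.BirchSwinnertonDyer.Theses.TameQuarticManinParity
import Literature.NumberTheory.ModularSymbols.CuspidalHomologyShiftSubOneFibreModThree
import Literature.NumberTheory.EllipticCurves.CuspFormTwistHecke
import HarnessLib

/-!
# Route `TameQuarticManinParity`: MS `TprimeIrrModThreeSaturation` (stmt-BirchSwinnertonDyer-23367) from
# H1 `TprimeIrrNormImageAvoidsThree` (stmt-23479) and H2 `TprimeIrrPrymDefectAvoidsThree` (stmt-23480), BY NAME

Lead seat `cruxlead-stmt-BirchSwinnertonDyer-23367` g0 (line `abelian-fixed-points` = the pen bsd-idea-3 g9's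
LINE 29 split «MS_of without multiplicity one»; director-bsd (287)(d): land the glue as Theorems
`--supports stmt-BirchSwinnertonDyer-23367`). THEOREMS ONLY: no definition, no named fact, no `sorry`; no Galois
structure and no multiplicity-one statement is used anywhere in this file.

## Content

* lattice lemmas on `Λ = H₁(X₀(N), ℤ)` / `Λ₁ = (t − 1)Λ` / `V₁(𝔽₃) = 𝔽₃ ⊗ Λ₁` (carriers p660800 · p661679 · p662714 ·
  p665446 · p666957): `coe_heckeOne_sub_smul_one_pow_apply` (`(heckeOne − a)^k` is `(T_p − a)^k` through the Hecke
  ring), `toFibre_heckeOne_sub_smul_one`, `heckeOneR_sub_smul_one_pow_toFibre` (the fibre map transports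
  `(T̄_p − ā)^k`), `normInt_T_sub_pow_smul` (`Nm` commutes with `(T_p − a)^k`, `p ≠ 3`);
* `fixedPartAvoidsThree_of_normImage_of_prymDefect` : H1 → H2 → A29 (`TprimeIrrFixedPartAvoidsThree`, stmt-23478):
  a `t̄`-fixed joint generalised `ā(W)`-eigenvector of `V₁(𝔽₃)` is `1 ⊗ x`, `x = (1 − t)(t − 1)w = 3tw − Nm w`; the
  eigen-equations give `(T_p − a_p)^k x ∈ 3Λ₁`, so `Nm((T_p − a_p)^k w) ∈ 3Λ` and H1 gives `Nm w = 3u`; then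
  `x = 3y`, `y = tw − u ∈ Λ_P` with `(T_p − a_p)^k y ∈ Λ₁`, so H2 gives `y ∈ Λ₁` and `1 ⊗ x = 0`;
* `modThreeSaturation_of_fixedPartAvoidsThree` : A29 → MS: eigen-conjunct from the tree's
  `IsNewformOf.heckeT_charTwist` (p664243) with `a_p := χ₋₃(p)·a_p(W)` (`χ(2) = −1`:
  `dirichletCharacter_three_apply_two'`), saturation conjunct from the tree's
  `genIsotypicOne_le_range_of_inf_ker_eq_bot` (p666957), since `χ₋₃·(χ₋₃·ā) = ā`;
* `tprimeIrrModThreeSaturation_of_normImage_of_prymDefect` : H1 → H2 → MS.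

CREDIT RULE: GLUE. MS (hence O22, stmt-28139) remains OPEN — its open content is exactly H1 ∧ H2; no summit is proved;
BSD is NOT proved by this file.
-/

set_option autoImplicit false
-- D-0017: single-problem summit, so `Summit.BirchSwinnertonDyer.BirchSwinnertonDyer.…` repeats a namespace BY DESIGN.
set_option linter.dupNamespace false

noncomputable section

open scoped ModularForm

open CongruenceSubgroup

namespace Summit.BirchSwinnertonDyer.BirchSwinnertonDyer.Theorems.TameQuarticManinParity

open Literature.NumberTheory.EllipticCurves Literature.NumberTheory.EllipticCurves.ModularForms
  Literature.NumberTheory.ModularSymbols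
  Summit.BirchSwinnertonDyer.BirchSwinnertonDyer.Theses.TameQuarticManinParity

/-! ### Lattice lemmas -/

section Lattice

variable {N : ℕ} [NeZero N] (h9 : 3 ^ 2 ∣ N)

set_option maxHeartbeats 800000 in
-- pointwise identities on the subtype carrier `↥(range (t_* − 1))` are whnf-heavy (cf. p662714, p665446)
/-- On `Λ₁`, the operator `(heckeOne − a)^k` is `(T_p − a)^k` acting through the Hecke ring. [folklore] -/
theorem coe_heckeOne_sub_smul_one_pow_apply {p : ℕ} (hp : p.Prime) (hp3 : p ≠ 3) (a : ℤ) (k : ℕ)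
    (x : shiftSubOneLattice N h9) :
    ((((heckeOne h9 hp hp3 - a • (1 : Module.End ℤ (shiftSubOneLattice N h9))) ^ k) x :
        shiftSubOneLattice N h9) : periodHomologyHecke N) =
      (HeckeRing0.T N 2 p hp - (a : HeckeRing0 N 2)) ^ k • (x : periodHomologyHecke N) := by
  induction k with
  | zero => rw [pow_zero, pow_zero, Module.End.one_apply, one_smul]
  | succ k ih =>
    rw [pow_succ', Module.End.mul_apply, pow_succ', mul_smul, ← ih, LinearMap.sub_apply,
      LinearMap.smul_apply, Module.End.one_apply, Submodule.coe_sub, Submodule.coe_smul_of_tower,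
      coe_heckeOne, sub_smul, Int.cast_smul_eq_zsmul]

/-- The fibre map intertwines `heckeOne − a` on `Λ₁` with `T̄_p − ā` on `V₁(𝔽₃)`. [folklore] -/
theorem toFibre_heckeOne_sub_smul_one {p : ℕ} (hp : p.Prime) (hp3 : p ≠ 3) (a : ℤ)
    (z : shiftSubOneLattice N h9) :
    toFibre N h9 (ZMod 3) ((heckeOne h9 hp hp3 - a • (1 : Module.End ℤ (shiftSubOneLattice N h9))) z) =
      (heckeOneR h9 hp hp3 (R := ZMod 3) -
          (a : ZMod 3) • (1 : Module.End (ZMod 3) (ShiftSubOneModule N h9 (ZMod 3)))) (toFibre N h9 (ZMod 3) z) := by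
  have h1 : toFibre N h9 (ZMod 3) ((heckeOne h9 hp hp3 - a • (1 : Module.End ℤ (shiftSubOneLattice N h9))) z) =
      toFibre N h9 (ZMod 3) (heckeOne h9 hp hp3 z) - toFibre N h9 (ZMod 3) (a • z) := by
    rw [← map_sub]
    rfl
  have h2 : (heckeOneR h9 hp hp3 (R := ZMod 3) -
        (a : ZMod 3) • (1 : Module.End (ZMod 3) (ShiftSubOneModule N h9 (ZMod 3)))) (toFibre N h9 (ZMod 3) z) =
      heckeOneR h9 hp hp3 (R := ZMod 3) (toFibre N h9 (ZMod 3) z) - (a : ZMod 3) • toFibre N h9 (ZMod 3) z :=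
    rfl
  rw [h1, h2, toFibre_heckeOne, intCast_smul_toFibre]

/-- The fibre map transports `(T̄_p − ā)^k` on `V₁(𝔽₃)` back to `(heckeOne − a)^k` on `Λ₁`. [folklore] -/
theorem heckeOneR_sub_smul_one_pow_toFibre {p : ℕ} (hp : p.Prime) (hp3 : p ≠ 3) (a : ℤ) (k : ℕ)
    (x : shiftSubOneLattice N h9) :
    ((heckeOneR h9 hp hp3 (R := ZMod 3) - (a : ZMod 3) • (1 : Module.End (ZMod 3) (ShiftSubOneModule N h9 (ZMod 3)))) ^ k)
        (toFibre N h9 (ZMod 3) x) =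
      toFibre N h9 (ZMod 3) (((heckeOne h9 hp hp3 - a • (1 : Module.End ℤ (shiftSubOneLattice N h9))) ^ k) x) := by
  have hsemi : Function.Semiconj (toFibre N h9 (ZMod 3))
      (heckeOne h9 hp hp3 - a • (1 : Module.End ℤ (shiftSubOneLattice N h9)))
      (heckeOneR h9 hp hp3 (R := ZMod 3) -
        (a : ZMod 3) • (1 : Module.End (ZMod 3) (ShiftSubOneModule N h9 (ZMod 3)))) :=
    fun z ↦ toFibre_heckeOne_sub_smul_one h9 hp hp3 a z
  rw [Module.End.coe_pow, Module.End.coe_pow]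
  exact (hsemi.iterate_right k x).symm

/-- `Nm` commutes with `(T_p − a)^k` on `Λ` (`p ≠ 3`). [folklore] -/
theorem normInt_T_sub_pow_smul {p : ℕ} (hp : p.Prime) (hp3 : p ≠ 3) (a : ℤ) (k : ℕ)
    (w : periodHomologyHecke N) :
    normInt N h9 ((HeckeRing0.T N 2 p hp - (a : HeckeRing0 N 2)) ^ k • w) =
      (HeckeRing0.T N 2 p hp - (a : HeckeRing0 N 2)) ^ k • normInt N h9 w := by
  induction k generalizing w with
  | zero => rw [pow_zero, one_smul, one_smul]
  | succ k ih =>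
    rw [pow_succ', mul_smul, mul_smul, sub_smul, sub_smul, map_sub, normInt_smul_T h9 hp hp3,
      Int.cast_smul_eq_zsmul, Int.cast_smul_eq_zsmul, map_zsmul, ih]

end Lattice

/-! ### A29 from H1 and H2 -/

set_option maxHeartbeats 800000 in
-- the lattice bookkeeping elaborates on the subtype/tensor carriers (whnf-heavy, cf. p662714, p665446)
/-- **A29 ⟸ H1 ∧ H2** (`TprimeIrrFixedPartAvoidsThree`, stmt-BirchSwinnertonDyer-23478, from
`TprimeIrrNormImageAvoidsThree` and `TprimeIrrPrymDefectAvoidsThree`): with `S = S₁ ∪ S₂`, a `t̄`-fixed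
joint generalised `ā(W)`-eigenvector `φ ∈ V₁(𝔽₃)` is `1 ⊗ x`, `x = (1 − t)(t − 1)w = 3tw − Nm w`
(`(1 − t)² = Nm − 3t`); the eigen-equations pull back to `(T_p − a_p)^k x ∈ 3Λ₁`, whence
`Nm((T_p − a_p)^k w) = (T_p − a_p)^k Nm w ∈ 3Λ` (`p ∈ S₁`) and H1 gives `Nm w = 3u`; so `x = 3y`,
`y = tw − u ∈ Λ_P` (saturation of `Λ_P`), `3(T_p − a_p)^k y ∈ 3Λ₁` so `(T_p − a_p)^k y ∈ Λ₁`
(`p ∈ S₂`, torsion-freeness) and H2 gives `y ∈ Λ₁`, i.e. `φ = 1 ⊗ 3y = 0`. [folklore] -/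
theorem fixedPartAvoidsThree_of_normImage_of_prymDefect
    (h1 : TprimeIrrNormImageAvoidsThree) (h2 : TprimeIrrPrymDefectAvoidsThree) :
    TprimeIrrFixedPartAvoidsThree := by
  intro W _ _ _ hCM hA hS hirr hv h9
  obtain ⟨S₁, hS₁⟩ := h1 W hCM hA hS hirr hv h9
  obtain ⟨S₂, hS₂⟩ := h2 W hCM hA hS hirr hv h9
  classical
  refine ⟨S₁ ∪ S₂, ?_⟩
  haveI := isAddTorsionFree_periodHomologyHecke (W.conductorNorm ℤ)
  rw [eq_bot_iff]
  intro φ hφ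
  obtain ⟨hgen, hker⟩ := Submodule.mem_inf.mp hφ
  rw [Submodule.mem_bot]
  -- `φ ∈ ker(1 − t̄) = im(1 − t̄)`: `φ = (1 − t̄)(1 ⊗ y') = 1 ⊗ (1 − t)y'`, `y' = tw − w`
  rw [ker_one_sub_shiftOneR_eq_range, LinearMap.mem_range] at hker
  obtain ⟨ψ, rfl⟩ := hker
  obtain ⟨y', rfl⟩ := toFibre_zmod_surjective (W.conductorNorm ℤ) h9 3 ψ
  rw [one_sub_shiftOneR_toFibre] at hgen ⊢
  obtain ⟨w, hw⟩ := (mem_shiftSubOneLattice_iff (W.conductorNorm ℤ) h9 _).mp y'.2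
  obtain ⟨x, hxdef⟩ : ∃ x : shiftSubOneLattice (W.conductorNorm ℤ) h9,
      (1 - shiftOne (W.conductorNorm ℤ) h9) y' = x := ⟨_, rfl⟩
  rw [hxdef] at hgen ⊢
  have hxval : (x : periodHomologyHecke (W.conductorNorm ℤ)) =
      (3 : ℤ) • shiftInt (W.conductorNorm ℤ) h9 w - normInt (W.conductorNorm ℤ) h9 w := by
    rw [← hxdef, LinearMap.sub_apply, Module.End.one_apply, Submodule.coe_sub, coe_shiftOne, ← hw, map_sub,
      normInt_apply]
    abel
  -- the eigen-equations on the lattice: `(T_p − a_p)^k x = 3 x'_p`, `x'_p ∈ Λ₁`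
  have hgen' : ∀ (p : ℕ) (hp : p.Prime), p ≠ 3 → p ∈ S₁ ∪ S₂ →
      ∃ (k : ℕ) (x' : shiftSubOneLattice (W.conductorNorm ℤ) h9),
        (HeckeRing0.T (W.conductorNorm ℤ) 2 p hp - (W.LFunction p : HeckeRing0 (W.conductorNorm ℤ) 2)) ^ k •
            (x : periodHomologyHecke (W.conductorNorm ℤ)) =
          (3 : ℤ) • (x' : periodHomologyHecke (W.conductorNorm ℤ)) := by
    intro p hp hp3 hpS
    have hmem : toFibre (W.conductorNorm ℤ) h9 (ZMod 3) x ∈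
        (heckeOneR h9 hp hp3 (R := ZMod 3)).maxGenEigenspace ((W.LFunction p : ℤ) : ZMod 3) := by
      have h := hgen
      simp only [SetLike.mem_coe, genIsotypicOne, Submodule.mem_iInf] at h
      exact h p hp hp3 hpS
    obtain ⟨k, hk⟩ := (Module.End.mem_maxGenEigenspace _ _ _).mp hmem
    rw [heckeOneR_sub_smul_one_pow_toFibre h9 hp hp3, toFibre_zmod_eq_zero_iff] at hk
    obtain ⟨x', hx'⟩ := hk
    refine ⟨k, x', ?_⟩
    rw [← coe_heckeOne_sub_smul_one_pow_apply h9 hp hp3 (W.LFunction p) k x, ← hx', Submodule.coe_smul_of_tower,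
      Nat.cast_ofNat]
  -- H1: `Nm w ∈ 3Λ`
  obtain ⟨u, hu⟩ : ∃ u : periodHomologyHecke (W.conductorNorm ℤ),
      normInt (W.conductorNorm ℤ) h9 w = (3 : ℕ) • u := by
    refine hS₁ w fun p hp hp3 hp1 ↦ ?_
    obtain ⟨k, x', hk⟩ := hgen' p hp hp3 (Finset.mem_union_left _ hp1)
    refine ⟨k, (HeckeRing0.T (W.conductorNorm ℤ) 2 p hp -
        (W.LFunction p : HeckeRing0 (W.conductorNorm ℤ) 2)) ^ k • shiftInt (W.conductorNorm ℤ) h9 w -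
          (x' : periodHomologyHecke (W.conductorNorm ℤ)), ?_⟩
    have hNm : normInt (W.conductorNorm ℤ) h9 w =
        (3 : ℤ) • shiftInt (W.conductorNorm ℤ) h9 w - (x : periodHomologyHecke (W.conductorNorm ℤ)) := by
      rw [hxval]; abel
    rw [normInt_T_sub_pow_smul h9 hp hp3, hNm, smul_sub, hk, ← Nat.cast_smul_eq_nsmul ℤ, Nat.cast_ofNat,
      smul_sub, smul_comm ((HeckeRing0.T (W.conductorNorm ℤ) 2 p hp -
        (W.LFunction p : HeckeRing0 (W.conductorNorm ℤ) 2)) ^ k) (3 : ℤ) (shiftInt (W.conductorNorm ℤ) h9 w)]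
  -- `x = 3y`, `y := tw − u ∈ Λ_P`
  have hxy : (x : periodHomologyHecke (W.conductorNorm ℤ)) =
      (3 : ℤ) • (shiftInt (W.conductorNorm ℤ) h9 w - u) := by
    rw [hxval, hu, smul_sub, ← Nat.cast_smul_eq_nsmul ℤ, Nat.cast_ofNat]
  have hyP : shiftInt (W.conductorNorm ℤ) h9 w - u ∈ prymLattice (W.conductorNorm ℤ) h9 := by
    rw [← smul_mem_prymLattice_iff (W.conductorNorm ℤ) h9 (by norm_num : (3 : ℤ) ≠ 0), ← hxy]
    exact shiftSubOneLattice_le_prymLattice (W.conductorNorm ℤ) h9 x.2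
  -- H2: `y ∈ Λ₁`
  have hy1 : shiftInt (W.conductorNorm ℤ) h9 w - u ∈ shiftSubOneLattice (W.conductorNorm ℤ) h9 := by
    refine hS₂ _ hyP fun p hp hp3 hp2 ↦ ?_
    obtain ⟨k, x', hk⟩ := hgen' p hp hp3 (Finset.mem_union_right _ hp2)
    refine ⟨k, ?_⟩
    have h3 : (3 : ℕ) • ((HeckeRing0.T (W.conductorNorm ℤ) 2 p hp -
        (W.LFunction p : HeckeRing0 (W.conductorNorm ℤ) 2)) ^ k • (shiftInt (W.conductorNorm ℤ) h9 w - u)) =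
          (3 : ℕ) • (x' : periodHomologyHecke (W.conductorNorm ℤ)) := by
      rw [← Nat.cast_smul_eq_nsmul ℤ, ← Nat.cast_smul_eq_nsmul ℤ, Nat.cast_ofNat, ← smul_comm, ← hxy, hk]
    rw [nsmul_right_injective (by norm_num : (3 : ℕ) ≠ 0) h3]
    exact x'.2
  -- conclude
  rw [toFibre_zmod_eq_zero_iff]
  refine ⟨⟨shiftInt (W.conductorNorm ℤ) h9 w - u, hy1⟩, Subtype.ext ?_⟩
  rw [Submodule.coe_smul_of_tower, Nat.cast_ofNat, hxy]

/-- A primitive quadratic Dirichlet character mod `3` is the Legendre symbol: `χ(2) = -1` (a copy of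
`dirichletCharacter_three_apply_two` of `TameQuarticManinParityOrientationOfPeriodSaturation`, reproved here to
keep this file's imports route-independent apart from the route file itself). [folklore] -/
theorem dirichletCharacter_three_apply_two' {χ : DirichletCharacter ℂ 3} (hχ : χ.IsQuadratic)
    (hprim : χ.IsPrimitive) : χ (2 : ZMod 3) = -1 := by
  have hu : IsUnit (2 : ZMod 3) := by decide
  rcases sq_eq_one_iff.mp (apply_sq_eq_one_of_isQuadratic hχ hu) with h | h
  · exfalso
    have h1 : χ = 1 := by
      refine MulChar.ext fun a ↦ ?_
      rw [MulChar.one_apply_coe]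
      have ha : (a : ZMod 3) = 1 ∨ (a : ZMod 3) = 2 := by
        have h0 : (a : ZMod 3) ≠ 0 := a.ne_zero
        revert h0
        generalize (a : ZMod 3) = x
        decide +revert
      rcases ha with ha | ha
      · rw [ha, map_one]
      · rw [ha, h]
    have hc := (DirichletCharacter.isPrimitive_def χ).mp hprim
    rw [h1, DirichletCharacter.conductor_one] at hc
    norm_num at hc
  · exact h

/-! ### MS from A29 -/

/-- **MS ⟸ A29** (`TprimeIrrModThreeSaturation`, stmt-BirchSwinnertonDyer-23367, from
`TprimeIrrFixedPartAvoidsThree`, stmt-BirchSwinnertonDyer-23478): take the `S` of A29 and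
`a_p := χ₋₃(p)·a_p(W)`; the eigen-equations `T_p (D.f ⊗ χ) = a_p (D.f ⊗ χ)` are the tree's
`IsNewformOf.heckeT_charTwist` (`χ(p) = χ₋₃(p)` for the primitive quadratic character mod `3`), and
`V₁(𝔽₃)[ā^∞] ⊆ (1 − t̄)V₁(𝔽₃)` is the tree's `genIsotypicOne_le_range_of_inf_ker_eq_bot` applied to the
vanishing of A29 for the twisted system `χ₋₃·ā = ā(W)`. [folklore] -/
theorem modThreeSaturation_of_fixedPartAvoidsThree (hA : TprimeIrrFixedPartAvoidsThree) :
    TprimeIrrModThreeSaturation := by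
  intro W _ _ _ hCM hA3 hS hirr hv D h9 χ hχ hprim
  obtain ⟨S, hS0⟩ := hA W hCM hA3 hS hirr hv h9
  -- the twisted integer system
  let a : ℕ → ℤ := fun p ↦ (if p % 3 = 1 then 1 else -1) * W.LFunction p
  refine ⟨S, a, fun p hp hp3 _ ↦ ?_, ?_⟩
  · -- eigen-equations for `f* = D.f ⊗ χ`
    haveI : NeZero p := ⟨hp.ne_zero⟩
    have hpm : ¬ p ∣ 3 := fun h ↦ hp3 ((Nat.prime_dvd_prime_iff_eq hp Nat.prime_three).mp h)
    have hT := D.isNewformOf.heckeT_charTwist (W.conductorNorm ℤ) (dvd_refl _) h9 hχ hprim hp hpm Iff.rfl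
    rw [HeckeRing0.toEnd_T, hT]
    congr 1
    -- `χ(p) = ±1` according to `p mod 3`
    have hmod : p % 3 = 1 ∨ p % 3 = 2 := by
      have h0 : p % 3 ≠ 0 := fun h0 ↦
        hp3 ((Nat.prime_dvd_prime_iff_eq Nat.prime_three hp).mp (Nat.dvd_of_mod_eq_zero h0)).symm
      have hlt : p % 3 < 3 := Nat.mod_lt _ (by norm_num)
      omega
    have hcast : ((p : ℕ) : ZMod 3) = ((p % 3 : ℕ) : ZMod 3) := by
      rw [← ZMod.natCast_mod p 3]
    rcases hmod with h1 | h2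
    · simp only [a, h1, if_true, one_mul]
      rw [hcast, h1, Nat.cast_one, map_one, one_mul]
    · simp only [a, h2, show (2 : ℕ) ≠ 1 by decide, if_false, neg_one_mul, Int.cast_neg]
      rw [hcast, h2, Nat.cast_ofNat, dirichletCharacter_three_apply_two' hχ hprim]
      ring
  · -- saturation from the vanishing of A29 for the twisted system `χ₋₃ · ā = ā(W)`
    refine genIsotypicOne_le_range_of_inf_ker_eq_bot (W.conductorNorm ℤ) h9 (↑S) (fun p ↦ (a p : ZMod 3)) ?_
    have htw : twistSystem (ZMod 3) (fun p ↦ (a p : ZMod 3)) = fun p ↦ ((W.LFunction p : ℤ) : ZMod 3) := by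
      funext p
      rw [twistSystem_apply, twistSign]
      simp only [a, Int.cast_mul]
      split_ifs with h
      · push_cast
        ring
      · push_cast
        ring
    rw [htw]
    exact hS0

/-! ### MS from H1 and H2 -/

/-- **MS ⟸ H1 ∧ H2** (LINE 29 / line `abelian-fixed-points` glue, both hypotheses route decls by name):
`TprimeIrrNormImageAvoidsThree` (stmt-BirchSwinnertonDyer-23479) and `TprimeIrrPrymDefectAvoidsThree`
(stmt-BirchSwinnertonDyer-23480) imply `TprimeIrrModThreeSaturation` (stmt-BirchSwinnertonDyer-23367), through
A29. Glue only: MS stays open (its content is H1 ∧ H2); no summit is proved; BSD is not proved by this. [folklore] -/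
theorem tprimeIrrModThreeSaturation_of_normImage_of_prymDefect
    (h1 : TprimeIrrNormImageAvoidsThree) (h2 : TprimeIrrPrymDefectAvoidsThree) :
    TprimeIrrModThreeSaturation :=
  modThreeSaturation_of_fixedPartAvoidsThree (fixedPartAvoidsThree_of_normImage_of_prymDefect h1 h2)

end Summit.BirchSwinnertonDyer.BirchSwinnertonDyer.Theorems.TameQuarticManinParity

end
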